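import Summits.ValiantsHypothesis.ValiantsHypothesis.Theses.ValuativeGCT

/-!
# `ValuativeGCT.CutBites` (stmt-ValiantsHypothesis-12626), line adjugate-pfaffian-kernel — Stub 6 `stub_adjDet_sparsePoint`

The sparse skew point of the witness `W_m = det (Σ_k cof X_(k,k))` (`cof Y = Y.adjugateᵀ`, `X_(k,k)` = row `(k,k)`
of a point of `End(ℂ^{m×m})` reshaped to an `m × m` matrix): for odd `m ≥ 3` there is a point all of whose rows are
skew-symmetric matrices at which `W_m ≠ 0`.

Mathematics.  Write `m = n + 1`, `n` even, and let `J` be an invertible skew matrix of size `n` (block diagonal of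
`!![0, 1; -1, 0]`).  The skew matrix `S = 0 ⊕ J` of size `n + 1` (zero row and column at index `0`) has
`adjugate S = det J • E₀₀` (every other cofactor has a zero row or a zero column), hence the skew matrix
`S_k := S.submatrix (swap 0 k) (swap 0 k)` has `cof S_k = det J • E_kk`.  At the point whose row `(k,k)` is `vec S_k`
and whose other rows vanish the witness evaluates to `det (Σ_k det J • E_kk) = det (det J • 1) = det J ^ (n+1) ≠ 0`.
This is the only place of the line where `Odd m` (and `3 ≤ m`) is used. [folklore]
-/

namespace Summit.ValiantsHypothesis.ValiantsHypothesis.Theorems.CutBitesAdjugate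

open Literature.NumberTheory.DiophantineGeometry Literature.Computability.AlgebraicComplexity
open MvPolynomial
open scoped BigOperators Matrix

-- `Summit.ValiantsHypothesis.ValiantsHypothesis.…` is the tree's mandated single-conjunct layout (Sub = Summit).
set_option linter.dupNamespace false

/-- For every even `n` there is a skew-symmetric `n × n` complex matrix with non-zero determinant: the block diagonal
matrix of `n/2` copies of `!![0, 1; -1, 0]` (determinant `1`). [folklore] -/
theorem cbAdj_exists_skew_det_ne_zero (n : ℕ) (hn : Even n) :
    ∃ J : Matrix (Fin n) (Fin n) ℂ, (∀ a b, J a b = -J b a) ∧ J.det ≠ 0 := by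
  obtain ⟨h, rfl⟩ := hn
  let e : Fin 2 × Fin h ≃ Fin (h + h) := finProdFinEquiv.trans (finCongr (two_mul h))
  refine ⟨Matrix.reindex e e (Matrix.blockDiagonal fun _ : Fin h => !![(0 : ℂ), 1; -1, 0]), ?_, ?_⟩
  · intro a b
    simp only [Matrix.reindex_apply, Matrix.submatrix_apply]
    generalize e.symm a = x
    generalize e.symm b = y
    obtain ⟨i, k⟩ := x
    obtain ⟨j, k'⟩ := y
    rw [Matrix.blockDiagonal_apply', Matrix.blockDiagonal_apply']
    by_cases hk : k = k'
    · subst hk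
      simp only [if_true]
      fin_cases i <;> fin_cases j <;> simp
    · rw [if_neg hk, if_neg (Ne.symm hk), neg_zero]
  · rw [Matrix.det_reindex_self, Matrix.det_blockDiagonal]
    simp [Matrix.det_fin_two_of]

/-- Adjugate of a square matrix of size `n + 1` whose row `0` and column `0` vanish: the only (possibly) non-zero
entry is the `(0,0)` one, equal to the determinant of the complementary minor. [folklore] -/
theorem cbAdj_adjugate_padded {R : Type*} [CommRing R] {n : ℕ} (S : Matrix (Fin (n + 1)) (Fin (n + 1)) R)
    (hrow : ∀ j, S 0 j = 0) (hcol : ∀ i, S i 0 = 0) (i j : Fin (n + 1)) :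
    S.adjugate i j = if i = 0 ∧ j = 0 then (S.submatrix Fin.succ Fin.succ).det else 0 := by
  split_ifs with h
  · rw [h.1, h.2, Matrix.adjugate_fin_succ_eq_det_submatrix, Fin.succAbove_zero]
    simp
  · rw [Matrix.adjugate_apply]
    by_cases hj : j = 0
    · subst hj
      have hi : i ≠ 0 := fun hi => h ⟨hi, rfl⟩
      refine Matrix.det_eq_zero_of_column_eq_zero 0 fun a => ?_
      by_cases ha : a = 0
      · subst ha
        rw [Matrix.updateRow_self, Pi.single_apply, if_neg hi.symm]
      · rw [Matrix.updateRow_ne ha, hcol]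
    · refine Matrix.det_eq_zero_of_row_eq_zero 0 fun c => ?_
      rw [Matrix.updateRow_ne (Ne.symm hj), hrow]

/-- For `S` of size `n + 1` with vanishing row `0` and column `0`, the sum over `k` of the cofactor matrices of the
conjugates `S.submatrix (swap 0 k) (swap 0 k)` is the scalar matrix `det (minor) • 1`. [folklore] -/
theorem cbAdj_sum_cof_swap {R : Type*} [CommRing R] {n : ℕ} (S : Matrix (Fin (n + 1)) (Fin (n + 1)) R)
    (hrow : ∀ j, S 0 j = 0) (hcol : ∀ i, S i 0 = 0) :
    ∑ k : Fin (n + 1), (S.submatrix (Equiv.swap 0 k) (Equiv.swap 0 k)).adjugateᵀ =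
      (S.submatrix Fin.succ Fin.succ).det • (1 : Matrix (Fin (n + 1)) (Fin (n + 1)) R) := by
  ext a b
  rw [Matrix.sum_apply]
  simp only [Matrix.transpose_apply, Matrix.adjugate_submatrix_equiv_self, Matrix.submatrix_apply,
    cbAdj_adjugate_padded S hrow hcol, Equiv.swap_apply_eq_iff, Equiv.swap_apply_left]
  by_cases hab : a = b
  · subst hab
    simp
  · rw [Matrix.smul_apply, Matrix.one_apply_ne hab, smul_zero]
    refine Finset.sum_eq_zero fun k _ => ?_
    rw [if_neg]
    rintro ⟨rfl, rfl⟩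
    exact hab rfl

/-- Evaluation of the witness `W_m = det (Σ_k cof X_(k,k))` at a point `p`: it is `det (Σ_k cof P_k)` with `P_k` the
row `(k,k)` of `p` reshaped to an `m × m` matrix (`eval` is a ring map, so it commutes with `det`, sums, `adjugate`
and transpose). [folklore] -/
theorem cbAdj_eval_witness (m : ℕ) (p : MatIdx m × MatIdx m → ℂ) :
    MvPolynomial.eval p (Matrix.det (∑ k : Fin m, (Matrix.of fun a b : Fin m =>
        (X (toLex (k, k), toLex (a, b)) : MvPolynomial (MatIdx m × MatIdx m) ℂ)).adjugateᵀ)) =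
      Matrix.det (∑ k : Fin m, (Matrix.of fun a b : Fin m => p (toLex (k, k), toLex (a, b))).adjugateᵀ) := by
  rw [RingHom.map_det, map_sum]
  congr 1
  refine Finset.sum_congr rfl fun k _ => ?_
  rw [RingHom.mapMatrix_apply, Matrix.transpose_map, ← RingHom.mapMatrix_apply, RingHom.map_adjugate,
    RingHom.mapMatrix_apply]
  congr 2
  ext a b
  simp

/-- **Stub 6 — the sparse skew point** (Pfaffian-kernel lever; uses `Odd m` and `3 ≤ m`): there is a point all of
whose rows are skew at which `W_m = det (Σ_k cof X_(k,k)) ≠ 0`.  With `m = n + 1`, `n` even, `J` an invertible skew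
matrix of size `n` and `S = 0 ⊕ J`, the point has row `(k,k)` equal to `vec (S.submatrix (swap 0 k) (swap 0 k))` and
all other rows `0`; the value is `det J ^ (n+1) ≠ 0`. [folklore] -/
theorem stub_adjDet_sparsePoint (m : ℕ) (hm : Odd m) (h3 : 3 ≤ m) :
    ∃ p : MatIdx m × MatIdx m → ℂ,
      (∀ j : MatIdx m, (fun i => p (j, i)) ∈
        Submodule.span ℂ {u : MatIdx m → ℂ | ∀ a b : Fin m, u (toLex (a, b)) = -u (toLex (b, a))}) ∧
      MvPolynomial.eval p (Matrix.det (∑ k : Fin m, (Matrix.of fun a b : Fin m =>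
        (X (toLex (k, k), toLex (a, b)) : MvPolynomial (MatIdx m × MatIdx m) ℂ)).adjugateᵀ)) ≠ 0 := by
  obtain ⟨n, rfl⟩ : ∃ n, m = n + 1 := ⟨m - 1, by omega⟩
  have hn : Even n := by
    obtain ⟨c, hc⟩ := hm
    exact ⟨c, by omega⟩
  obtain ⟨J, hJskew, hJdet⟩ := cbAdj_exists_skew_det_ne_zero n hn
  -- the padded skew matrix `S = 0 ⊕ J` (zero row and column at index `0`)
  set S : Matrix (Fin (n + 1)) (Fin (n + 1)) ℂ :=
    Matrix.of (Matrix.vecCons 0 fun a' => Matrix.vecCons 0 (J a')) with hS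
  have hrow : ∀ j, S 0 j = 0 := fun j => by simp [hS]
  have hcol : ∀ i, S i 0 = 0 := by
    refine Fin.cases ?_ (fun i => ?_) <;> simp [hS]
  have hminor : S.submatrix Fin.succ Fin.succ = J := by
    ext a b
    simp [hS]
  have hskew : ∀ a b, S a b = -S b a := by
    refine Fin.cases ?_ (fun a' => ?_) <;> refine Fin.cases ?_ (fun b' => ?_)
    · simp [hS]
    · simp [hS]
    · simp [hS]
    · simpa [hS] using hJskew a' b'
  refine ⟨fun q => if (ofLex q.1).1 = (ofLex q.1).2 then
      S (Equiv.swap 0 (ofLex q.1).1 (ofLex q.2).1) (Equiv.swap 0 (ofLex q.1).1 (ofLex q.2).2) else 0, ?_, ?_⟩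
  · intro j
    by_cases hj : (ofLex j).1 = (ofLex j).2
    · refine Submodule.subset_span ?_
      simp only [Set.mem_setOf_eq]
      intro a b
      simp only [if_pos hj, ofLex_toLex]
      exact hskew _ _
    · simp only [if_neg hj]
      exact Submodule.zero_mem _
  · rw [cbAdj_eval_witness]
    have hP : ∀ k : Fin (n + 1),
        (Matrix.of fun a b : Fin (n + 1) =>
          (fun q : MatIdx (n + 1) × MatIdx (n + 1) => if (ofLex q.1).1 = (ofLex q.1).2 then
            S (Equiv.swap 0 (ofLex q.1).1 (ofLex q.2).1) (Equiv.swap 0 (ofLex q.1).1 (ofLex q.2).2) else 0)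
            (toLex (k, k), toLex (a, b))) = S.submatrix (Equiv.swap 0 k) (Equiv.swap 0 k) := by
      intro k
      ext a b
      simp
    simp only [hP]
    rw [cbAdj_sum_cof_swap S hrow hcol, hminor, Matrix.det_smul, Matrix.det_one, mul_one, Fintype.card_fin]
    exact pow_ne_zero _ hJdet

end Summit.ValiantsHypothesis.ValiantsHypothesis.Theorems.CutBitesAdjugate
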